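import Literature.AlgebraicGeometry.Motives.HodgeStructureHalfTwistTensorEmbedding
import Literature.AlgebraicGeometry.Motives.HodgeStructureAbelianTypeTensor
import Literature.AlgebraicGeometry.Motives.HodgeStructureAbelianTypeSubobjects
import Literature.AlgebraicGeometry.Motives.HodgeTensorMorphisms
import Literature.AlgebraicGeometry.Motives.HodgeTensorFactsHolds
import Literature.AlgebraicGeometry.Motives.HodgeStructureTensorPolarization
import Literature.AlgebraicGeometry.Motives.HodgeStructureProdPolarization
import Literature.AlgebraicGeometry.Motives.HodgeStructureOfCMTypePolarization
import Literature.AlgebraicGeometry.ComplexMultiplication.CMTypeHodgeStructureAbelianType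
import Literature.NumberTheory.ComplexMultiplication.CMTypeBasic
import HarnessLib

/-!
# Half twists preserve abelian type and polarizability (van Geemen 2001, §2.9, §2.11), and the
# conjugate type: `V_{1/2}(-1) = V_{-1/2,Σ̄} ⊂ V ⊗ K_{-1/2}` (Prop. 2.8, second clause)

[topic AlgebraicGeometry/Motives]

Layer `Literature/AlgebraicGeometry/Motives`, lane `lit-hodgefound` (Track 2 foundations library, Layer A2/A3 junction «CM
Hodge structures ↔ CM abelian varieties»; prover seat `lit-hodgefound-p26`, gen 16, row g16-#4). DEFINITIONS WITH BODIES
(`conjLinear`, the conjugation isomorphisms `ofCMTypeConjHom` / `ofCMTypeConj` / `ofCMTypeConjInv` of `V¹_{(E,Φ)}` with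
`V¹_{(E,Φ̄)}`, and van Geemen's second inclusion `EndAction.posHalfTwistTateToTensor` with its retraction
`tensorToPosHalfTwistTate`) + THEOREMS; no named fact (net debt `0`). Sequel of row g16-#1
`Motives/HodgeStructureHalfTwistTensorEmbedding` (first and third clause of Prop. 2.8: `V{-1/2}_Θ` is a direct summand of
`V ⊗ V¹_{(E,Θ)}`, `V` is a direct summand of `V{1/2}_Θ ⊗ V¹_{(E,Θ)}`), whose docstring defers "the second clause
`V_{1/2}(-1) ⊂ V ⊗ K_{-1/2}` (it needs the conjugate type)", and of row g16-#2
`ComplexMultiplication/CMTypeHodgeStructureAbelianType` (`V¹_{(E,Θ)}` is of abelian type for a CM field `E`).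

## The source, verbatim

B. van Geemen, *Half twists of Hodge structures of CM-type*, J. Math. Soc. Japan 53 (2001) 813–833
[vanGeemen2001HalfTwists] (held text `paper:arxiv-math_0008076`, p0003–p0005). §1.2: "Let `V` be a Hodge structure such
that `V` is also a `K`-vector space for some CM-field `K` and such that the Hodge decomposition on `V` is stable under the
action of `K` […] We will then say that `V` is a Hodge structure of CM-type (with field `K`)." §1.3: "if we define as
usual `Σ̄ := {σ̄₁, …, σ̄_r}` then any embedding of `K` is either in `Σ` or in `Σ̄`." §1.4: "`V_{-1/2}^{r,s} :=
V^{r-1,s}_Σ ⊕ V^{r,s-1}_{Σ̄}` […] `V_{1/2}^{r,s} := V^{r+1,s}_Σ ⊕ V^{r,s+1}_{Σ̄}`". §2.6: "The `n`-th Tate twist of `V`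
is defined by `V(n) := V ⊗ ℚ(n)`, it is a Hodge structure of weight `k - 2n` with `V(n)^{p,q} = V^{p+n,q+n}`. […]
Therefore one has `(V_{m/2})(n) = (V(n))_{m/2}`."
**2.8 Proposition** (second clause). "If `V` admits a half twist, `V_{1/2}(-1)` is also a sub-Hodge structure of
`V ⊗_ℚ K_{-1/2}`: `V_{1/2}(-1) = { w ∈ V ⊗_ℚ K_{-1/2} : (x ⊗ 1) w = (1 ⊗ x̄) w, ∀ x ∈ K }`". Proof: "`x, x̄ ∈ K` are
eigenvalues of the `K`-linear extension of the action of `x` on `V ⊗_ℚ K` and we denote by `V'` and `V''` the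
corresponding eigenspaces […] `1 ⊗ g(z) = g(z̄) ⊗ 1` on `V''` […] `h(z) ⊗ g(z) = h(z) g(z̄) ⊗ 1 = z z̄ h(z) g(z⁻¹) ⊗ 1` on
`V''` which identifies the Hodge structure on `V''` with the one on `V_{1/2}(-1)`."
**2.9 Geometrical version of the half twist.** "The proposition shows that if `V` is a sub-Hodge structure of
`H^k(X, ℚ)` for some projective variety `X`, then `V_{1/2}(-1)` is a sub-Hodge structure of `H^k(X, ℚ) ⊗ H^1(A_K, ℚ)`,
which is itself a summand of `H^{k+1}(X × A_K, ℚ)`." (§2.7: "One can identify `K_{-1/2}` with `H^1(A_K, ℚ)` for an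
abelian variety `A_K` with CM by the field `K`".)

## What is formalized (the tree's `A.halfTwist Θ b = V{-b/2}_Θ`, so `V_{-1/2} = A.halfTwist Θ 1`, `V_{1/2} = A.halfTwist Θ (-1)`)

* §1 THE CONJUGATE TYPE. For the conjugate type `Θ̄` (`CMTypeOps.bar Θ`, as a set the complement of `Θ`; `Θ̄̄ = Θ` is the
  tree's `CMTypeOps.bar_bar` of `NumberTheory/Automorphic/IdeleClassCharacterConjugate`, not needed here):
  `halfTwistPiece_bar` (`V{-b/2}_{Θ̄}^{P,Q} = V{b/2}_Θ^{P-b,Q-b}`) and the identity of Hodge structures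
  **`halfTwist_bar_eq_cast`: `V{-b/2}_{Θ̄} = V{b/2}_Θ(-b)`** (weights `n + b` and `n + -b - 2(-b)` matched by
  `HodgeStructure.cast`), with the mirror form `halfTwist_neg_eq_cast`: `V{b/2}_Θ = V{-b/2}_{Θ̄}(b)` — at `b = 1` this is
  van Geemen's `V_{1/2}(-1)` "with `(1 ⊗ x̄)`", i.e. the POSITIVE half twist for `Σ` is the NEGATIVE half twist for `Σ̄`
  up to the Tate twist of §2.6; `halfTwistAction_halfTwist_neg_eq_cast` (`V{-b/2}{b/2} = V`). For a CM field `E`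
  (Mathlib's `NumberField.IsCMField`, complex conjugation `complexConj E`): `conjLinear` (`x ↦ x̄` as a `ℚ`-linear map),
  `embCoords_conjLinear_baseChange` (`(x̄)_τ = x_{τ̄}`), and the isomorphism of weight-one Hodge structures
  **`ofCMTypeConj Φ : V¹_{(E,Φ)} ⟶ V¹_{(E,Φ̄)}`**, `ofCMTypeConjInv`, mutually inverse (`x̄̄ = x`).
* §2 PROP. 2.8, SECOND CLAUSE. **`EndAction.posHalfTwistTateToTensor A Θ : Hom (V{1/2}_Θ(-1)) (V ⊗ V¹_{(E,Θ)})`**,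
  `w ↦ (1 ⊗ c)(j w)` (the diagonal embedding `j` of row g16-#1 for `Θ̄`, followed by `1 ⊗ (x ↦ x̄)`), with the retraction
  **`tensorToPosHalfTwistTate`** (`μ ∘ (1 ⊗ c)`), `tensorToPosHalfTwistTate_posHalfTwistTateToTensor_apply`: **`V_{1/2}(-1)`
  is a direct summand of `V ⊗_ℚ K_{-1/2}` in the category of `ℚ`-Hodge structures**; and "MORE PRECISELY"
  **`range_posHalfTwistTateToTensor_eq`**: its image is `{w : (ι x ⊗ 1) w = (1 ⊗ x̄·) w ∀ x}` = van Geemen's `V''`.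
* §3 ABELIAN TYPE (van Geemen §2.9 in the tree's language `IsOfAbelianType` = André's `ℳ(𝒜b)` on the Hodge side, for
  `V, E : Type`): for a Hodge structure `H` with an action `A` of a CM field `E` by Hodge endomorphisms (van Geemen's
  "CM-type with field `K`"; no condition on `dim_E V` or on the Mumford–Tate group) and any type `Θ`, `b ∈ ℤ`:
  `IsOfAbelianType.halfTwist_one` (`V{-1/2}` is a summand of `V ⊗ V¹_{(E,Θ)}`), `.of_halfTwist_neg_one` (GGK's rule),
  `.halfTwist_neg_one` (through `Θ̄` and the Tate twist), **`IsOfAbelianType.halfTwist`: `H` of abelian type ⟹ every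
  `V{-b/2}_Θ` is of abelian type**, and **`isOfAbelianType_halfTwist_iff`**; the geometric phrasing
  `IsOfAbelianType.halfTwist_of_injective` (a sub-Hodge structure, with a CM-field action, of a structure of abelian type
  has all its half twists of abelian type).
* §4 POLARIZABILITY (§2.11, first paragraph: "If `V` has a polarization, then also `V ⊗ K_{-1/2}` has a polarization (the
  tensor product polarization) and by restriction one obtains a polarization on `V_{1/2}`"; `V : Type` finite-dimensional,
  `E` a CM field): `IsPolarizable.halfTwist_one`, `.of_halfTwist_neg_one`, `.halfTwist_neg_one`, `.of_halfTwist_one`,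
  **`IsPolarizable.halfTwist`** (every `V{-b/2}_Θ` of a polarizable `V` is polarizable), **`isPolarizable_halfTwist_iff`**
  (the tree's `IsPolarizable.tensor` / `.of_injective` / `isPolarizable_ofCMType` = the Riemann form `Tr(ζ x̄ y)`).

SCOPE. `E` is a CM field in §1 (from `conjLinear` on), §2, §3 — van Geemen's standing hypothesis; the twist identities
of §1 hold for any number field. §3 is in universe `0` (row g16-#2 realises `V¹_{(E,Θ)}` through CM complex tori
`V : Type`). NOT here: van Geemen's `X × A_K` itself (the tree's `IsOfAbelianType` already names one abelian variety
whose tensor construction contains the structure; no product variety is built), §2.11's explicit form `Ψ'(v, w) = Ψ(v, αw)`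
for a `K`-compatible polarization `Ψ` (only polarizability is recorded), §3 (Abel–Jacobi / cycle-theoretic applications).
-- TODO(general form): none.

## References

* [vanGeemen2001HalfTwists] B. van Geemen, *Half twists of Hodge structures of CM-type*, J. Math. Soc. Japan 53 (2001)
  813–833: §1.2–§1.4, §2.5–§2.7, Prop. 2.8 (second clause and its proof), §2.9, §2.11.
* [DeligneHodgeII1971] P. Deligne, *Théorie de Hodge II*, Publ. Math. IHÉS 40 (1971): 1.1.12, 2.1.13–2.1.15.
* [GreenGriffithsKerr2012] M. Green, P. Griffiths, M. Kerr, *Mumford–Tate Groups and Domains: Their Geometry and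
  Arithmetic*, Annals of Mathematics Studies 183, Princeton University Press (2012): §V.B p. 159 (`V{-b/2}`), §V.D p. 163.
* [Andre1996Motifs] Y. André, *Pour une théorie inconditionnelle des motifs*, Publ. Math. IHÉS 83 (1996), §6.1 (p. 30).
-/

noncomputable section

open scoped TensorProduct

open Module NumberField

namespace Literature.AlgebraicGeometry.Motives

namespace HodgeStructure

open Literature.NumberTheory.ComplexMultiplication (CMTypeOps.bar CMTypeOps.mem_bar_iff)

universe u v

/-! ## §1 The conjugate type: `V{-b/2}_{Θ̄} = V{b/2}_Θ(-b)` and `V¹_{(E,Φ)} ≅ V¹_{(E,Φ̄)}` -/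

section ConjugateType

variable {V : Type u} [AddCommGroup V] [Module ℚ V] {n : ℤ} {E : Type v} [Field E] [NumberField E]
  {H : HodgeStructure V n} (A : EndAction H E) (Θ : CMType E)

namespace EndAction

/-- **`V{-b/2}_{Θ̄}^{P,Q} = V{b/2}_Θ^{P-b,Q-b}`**: exchanging `Θ` and `Θ̄` exchanges the roles of `V_+` and `V_-` in
`V{-b/2}^{P,Q} = V_+^{P-b,Q} ⊕ V_-^{P,Q-b}`. [cite: vanGeemen2001HalfTwists, §1.4] [cite: GreenGriffithsKerr2012, §V.B p. 159] -/
theorem halfTwistPiece_bar (b P Q : ℤ) :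
    A.halfTwistPiece (CMTypeOps.bar Θ) b P Q = A.halfTwistPiece Θ (-b) (P - b) (Q - b) := by
  rw [halfTwistPiece, halfTwistPiece, sup_comm]
  simp only [CMTypeOps.mem_bar_iff, not_not, sub_neg_eq_add, sub_add_cancel]

/-- **`V{-b/2}_{Θ̄} = V{b/2}_Θ(-b)` AS HODGE STRUCTURES** (van Geemen's `V_{1/2}(-1)`, "`(1 ⊗ x̄)`", at `b = 1`: twisting
by the conjugate type is the opposite twist followed by a Tate twist, `V(n)^{p,q} = V^{p+n,q+n}`; the weights `n + b` and
`n + -b - 2·(-b)` are matched by `HodgeStructure.cast`). [cite: vanGeemen2001HalfTwists, Prop. 2.8 (second clause) and §2.6] -/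
theorem halfTwist_bar_eq_cast (b : ℤ) :
    A.halfTwist (CMTypeOps.bar Θ) b = ((A.halfTwist Θ (-b)).tateTwist (-b)).cast (by ring) := by
  refine ext_of_piece fun P => ?_
  rw [A.halfTwist_piece (CMTypeOps.bar Θ) b (by ring), cast_piece, piece_tateTwist,
    A.halfTwist_piece Θ (-b) (by ring), halfTwistPiece_bar]
  have e1 : P + -b = P - b := by ring
  have e2 : n + b - P + -b = n + b - P - b := by ring
  rw [e1, e2]

/-- Mirror form: **`V{b/2}_Θ = V{-b/2}_{Θ̄}(b)`** — in particular the positive half twist `V_{1/2} = V{1/2}_Θ` is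
`V{-1/2}_{Θ̄}(1)`, the Tate twist of a NEGATIVE half twist. [cite: vanGeemen2001HalfTwists, Prop. 2.8 (second clause) and §2.6] -/
theorem halfTwist_neg_eq_cast (b : ℤ) :
    A.halfTwist Θ (-b) = ((A.halfTwist (CMTypeOps.bar Θ) b).tateTwist b).cast (by ring) := by
  refine ext_of_piece fun P => ?_
  rw [A.halfTwist_piece Θ (-b) (by ring), cast_piece, piece_tateTwist, A.halfTwist_piece (CMTypeOps.bar Θ) b (by ring),
    halfTwistPiece_bar]
  have e1 : P + b - b = P := by ring
  have e2 : n + -b - P + b - b = n + -b - P := by ring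
  rw [e1, e2]

/-- **`V{-b/2}{b/2} = V`**: twisting back returns the original Hodge structure (the tree's `halfTwist_halfTwist_piece`,
`halfTwist_zero_piece`; companion of row g16-#1's `halfTwistAction_neg_halfTwist_eq_cast`).
[cite: vanGeemen2001HalfTwists, §2.5 ("(V_{n/2})_{m/2} = V_{(n+m)/2}")] -/
theorem halfTwistAction_halfTwist_neg_eq_cast (b : ℤ) :
    (A.halfTwistAction Θ b).halfTwist Θ (-b) = H.cast (by ring) := by
  refine ext_of_piece fun P => ?_
  rw [A.halfTwist_halfTwist_piece Θ b (-b) (by ring), add_neg_cancel, cast_piece, ← A.halfTwist_piece Θ 0 (by ring),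
    halfTwist_zero_piece]

end EndAction

/-! ### The conjugation isomorphism `V¹_{(E,Φ)} ≅ V¹_{(E,Φ̄)}` of a CM field -/

open RealMult (embCoords embCoords_tmul)

variable (E) in
/-- Complex conjugation `x ↦ x̄` of the CM field `E` (Mathlib's `NumberField.IsCMField.complexConj`) as a `ℚ`-linear
endomorphism of the `ℚ`-space `E`. [cite: vanGeemen2001HalfTwists, §2.3 ("Denoting by x ↦ x̄ the complex conjugation on K")] -/
def conjLinear [IsCMField E] : E →ₗ[ℚ] E :=
  ((IsCMField.complexConj E).toRingEquiv.toRingHom.toRatAlgHom).toLinearMap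

variable [IsCMField E]

/-- `conjLinear E x = x̄`. [cite: vanGeemen2001HalfTwists, §2.3] -/
@[simp]
theorem conjLinear_apply (x : E) : conjLinear E x = IsCMField.complexConj E x := rfl

/-- `x̄̄ = x`. [cite: vanGeemen2001HalfTwists, §2.3] -/
theorem conjLinear_conjLinear (x : E) : conjLinear E (conjLinear E x) = x := by
  rw [conjLinear_apply, conjLinear_apply, IsCMField.complexConj_apply_apply]

/-- `conjLinear ∘ conjLinear = id`. [cite: vanGeemen2001HalfTwists, §2.3] -/
theorem conjLinear_comp_conjLinear : conjLinear E ∘ₗ conjLinear E = LinearMap.id :=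
  LinearMap.ext conjLinear_conjLinear

/-- `x̄ · y = (x · ȳ)‾`: conjugation intertwines multiplication by `x̄` and by `x`. [cite: vanGeemen2001HalfTwists, §2.3 ("σ_{r+i}(x) := σ_i(x̄)")] -/
theorem lmul_conjLinear_comp_conjLinear (x : E) :
    (Algebra.lmul ℚ E (conjLinear E x) : E →ₗ[ℚ] E) ∘ₗ conjLinear E = conjLinear E ∘ₗ (Algebra.lmul ℚ E x : E →ₗ[ℚ] E) := by
  ext y
  simp only [LinearMap.coe_comp, Function.comp_apply, conjLinear_apply]
  show IsCMField.complexConj E x * IsCMField.complexConj E y = IsCMField.complexConj E (x * y)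
  rw [map_mul]

/-- **`(x̄)_τ = x_{τ̄}`**: in the eigen-coordinates `V_ℂ = E ⊗ ℂ = ⊕_τ ℂ_τ`, conjugating `E` permutes the coordinates by
`τ ↦ τ̄` (`τ(ē) = conj(τ(e)) = τ̄(e)`). [cite: vanGeemen2001HalfTwists, §2.3 ("σ_{r+i}(φ(z₁,…,z_r)) = z̄_i")] -/
theorem embCoords_conjLinear_baseChange (x : ℂ ⊗[ℚ] E) (τ : E →+* ℂ) :
    embCoords E ((conjLinear E).baseChange ℂ x) τ = embCoords E x (ComplexEmbedding.conjugate τ) := by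
  induction x using TensorProduct.induction_on with
  | zero => simp
  | tmul z e =>
    rw [LinearMap.baseChange_tmul, embCoords_tmul, embCoords_tmul, conjLinear_apply,
      IsCMField.complexEmbedding_complexConj, ComplexEmbedding.conjugate_coe_eq]
  | add x y hx hy => simp only [map_add, Pi.add_apply, hx, hy]

/-- Conjugating `E` carries `⊕_{τ ∈ S} ℂ_τ` into `⊕_{τ̄ ∈ S} ℂ_τ`. [cite: vanGeemen2001HalfTwists, §2.3] -/
theorem map_conjLinear_baseChange_coordSubspace_le (S : Set (E →+* ℂ)) :
    (coordSubspace E S).map ((conjLinear E).baseChange ℂ) ≤ coordSubspace E (ComplexEmbedding.conjugate ⁻¹' S) := by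
  rintro _ ⟨x, hx, rfl⟩ τ hτ
  rw [embCoords_conjLinear_baseChange]
  exact (mem_coordSubspace_iff.1 hx) _ hτ

/-- **Conjugation `V¹_{(E,Φ)} ⟶ V¹_{(E,Ψ)}` is a morphism of Hodge structures whenever `Ψ = Φ̄`** (as sets, `Ψ = Φᶜ`):
`F¹ = ⊕_{φ ∈ Φ} ℂ_φ` goes to `⊕_{φ̄ ∈ Φ} ℂ_φ = ⊕_{φ ∈ Φ̄} ℂ_φ`, and `F⁰ = V_ℂ`, `F² = 0` are preserved. (Deligne 1982 §5 (b):
twisting the action by complex conjugation turns type `Φ` into type `Φ̄`.)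
[cite: vanGeemen2001HalfTwists, Prop. 2.8 (proof: "1 ⊗ g(z) = g(z̄) ⊗ 1 on V''")] -/
def ofCMTypeConjHom (Φ Ψ : CMType E) (hΨ : Ψ.1 = Φ.1ᶜ) : Hom (ofCMType Φ) (ofCMType Ψ) where
  toLinearMap := conjLinear E
  map_F_le p := by
    rw [ofCMType_F, ofCMType_F]
    by_cases hp : p ≤ 0
    · rw [twoStepFiltration_of_le_zero _ hp, twoStepFiltration_of_le_zero _ hp]
      exact le_top
    by_cases hp1 : p ≤ 1
    · rw [twoStepFiltration_of_pos_of_le _ (not_le.1 hp) hp1, twoStepFiltration_of_pos_of_le _ (not_le.1 hp) hp1, hΨ,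
        ← conjugate_preimage_cmType Φ]
      exact map_conjLinear_baseChange_coordSubspace_le Φ.1
    · rw [twoStepFiltration_of_lt _ (not_le.1 hp) (not_le.1 hp1), Submodule.map_bot]
      exact bot_le

/-- The underlying map of `ofCMTypeConjHom` is `x ↦ x̄`. [cite: vanGeemen2001HalfTwists, Prop. 2.8] -/
@[simp]
theorem ofCMTypeConjHom_toLinearMap (Φ Ψ : CMType E) (hΨ : Ψ.1 = Φ.1ᶜ) :
    (ofCMTypeConjHom Φ Ψ hΨ).toLinearMap = conjLinear E := rfl

/-- **`V¹_{(E,Φ)} ⟶ V¹_{(E,Φ̄)}`, `x ↦ x̄`, a morphism (isomorphism) of weight-one Hodge structures.**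
[cite: vanGeemen2001HalfTwists, Prop. 2.8 (second clause, proof)] -/
def ofCMTypeConj (Φ : CMType E) : Hom (ofCMType Φ) (ofCMType (CMTypeOps.bar Φ)) :=
  ofCMTypeConjHom Φ (CMTypeOps.bar Φ) rfl

/-- **`V¹_{(E,Φ̄)} ⟶ V¹_{(E,Φ)}`, `x ↦ x̄`**, the inverse morphism. [cite: vanGeemen2001HalfTwists, Prop. 2.8 (second clause, proof)] -/
def ofCMTypeConjInv (Φ : CMType E) : Hom (ofCMType (CMTypeOps.bar Φ)) (ofCMType Φ) :=
  ofCMTypeConjHom (CMTypeOps.bar Φ) Φ (compl_compl Φ.1).symm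

/-- Underlying map of `ofCMTypeConj`. [cite: vanGeemen2001HalfTwists, Prop. 2.8] -/
@[simp]
theorem ofCMTypeConj_toLinearMap (Φ : CMType E) : (ofCMTypeConj Φ).toLinearMap = conjLinear E := rfl

/-- Underlying map of `ofCMTypeConjInv`. [cite: vanGeemen2001HalfTwists, Prop. 2.8] -/
@[simp]
theorem ofCMTypeConjInv_toLinearMap (Φ : CMType E) : (ofCMTypeConjInv Φ).toLinearMap = conjLinear E := rfl

/-- `ofCMTypeConjInv ∘ ofCMTypeConj = id`. [cite: vanGeemen2001HalfTwists, Prop. 2.8] -/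
theorem ofCMTypeConjInv_comp_ofCMTypeConj (Φ : CMType E) :
    (ofCMTypeConjInv Φ).comp (ofCMTypeConj Φ) = Hom.id (ofCMType Φ) :=
  Hom.ext conjLinear_comp_conjLinear

/-- `ofCMTypeConj ∘ ofCMTypeConjInv = id`. [cite: vanGeemen2001HalfTwists, Prop. 2.8] -/
theorem ofCMTypeConj_comp_ofCMTypeConjInv (Φ : CMType E) :
    (ofCMTypeConj Φ).comp (ofCMTypeConjInv Φ) = Hom.id (ofCMType (CMTypeOps.bar Φ)) :=
  Hom.ext conjLinear_comp_conjLinear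

/-- Pointwise: `ofCMTypeConjInv (ofCMTypeConj x) = x`. [cite: vanGeemen2001HalfTwists, Prop. 2.8] -/
theorem ofCMTypeConjInv_ofCMTypeConj_apply (Φ : CMType E) (x : E) :
    (ofCMTypeConjInv Φ).toLinearMap ((ofCMTypeConj Φ).toLinearMap x) = x :=
  conjLinear_conjLinear x

/-- Pointwise: `ofCMTypeConj (ofCMTypeConjInv x) = x`. [cite: vanGeemen2001HalfTwists, Prop. 2.8] -/
theorem ofCMTypeConj_ofCMTypeConjInv_apply (Φ : CMType E) (x : E) :
    (ofCMTypeConj Φ).toLinearMap ((ofCMTypeConjInv Φ).toLinearMap x) = x :=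
  conjLinear_conjLinear x

end ConjugateType

/-! ## §2 Prop. 2.8, second clause: `V_{1/2}(-1) ⊂ V ⊗_ℚ K_{-1/2}` -/

namespace EndAction

section SecondClause

-- `V` and `E` in one universe, as in row g16-#1 §3 (the tree's tensor-piece lemma is stated that way).
variable {V : Type u} [AddCommGroup V] [Module ℚ V] {n : ℤ} {E : Type u} [Field E] [NumberField E] [IsCMField E]
  {H : HodgeStructure V n} [HodgeTensorFacts.{u, u}] (A : EndAction H E) (Θ : CMType E)

omit [IsCMField E] [HodgeTensorFacts.{u, u}] in
/-- `F^P` of `V_{1/2}(-1)` is `F^P` of `V{-1/2}_{Θ̄}` (from `halfTwist_bar_eq_cast`). [cite: vanGeemen2001HalfTwists, Prop. 2.8 (second clause)] -/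
theorem halfTwist_bar_one_F (P : ℤ) :
    (A.halfTwist (CMTypeOps.bar Θ) 1).F P =
      (((A.halfTwist Θ (-1)).tateTwist (-1)).cast (by ring : n + -1 - 2 * -1 = n + 1)).F P := by
  rw [A.halfTwist_bar_eq_cast Θ 1]

/-- **VAN GEEMEN'S SECOND INCLUSION `V_{1/2}(-1) ⟶ V ⊗_ℚ K_{-1/2}`**, `w ↦ (1 ⊗ (x ↦ x̄))(j w)`: the diagonal embedding
`j` of row g16-#1 for the conjugate type (`V_{1/2}(-1) = V{-1/2}_{Θ̄} ⟶ V ⊗ V¹_{(E,Θ̄)}`, Prop. 2.8 first clause for `Θ̄`)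
followed by `1 ⊗ (V¹_{(E,Θ̄)} ⟶ V¹_{(E,Θ)})` (conjugation, `ofCMTypeConjInv`) — a morphism of Hodge structures of weight
`n + 1`. Its image is van Geemen's `V''` (`range_posHalfTwistTateToTensor_eq`).
[cite: vanGeemen2001HalfTwists, Prop. 2.8 (second clause)] [cite: DeligneHodgeII1971, 1.1.12] -/
def posHalfTwistTateToTensor :
    Hom (((A.halfTwist Θ (-1)).tateTwist (-1)).cast (by ring : n + -1 - 2 * -1 = n + 1)) (H.tensor (ofCMType Θ)) where
  toLinearMap := (conjLinear E).lTensor V ∘ₗ A.tensorEmbedding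
  map_F_le P := by
    have h := ((Hom.tensorMap (Hom.id H) (ofCMTypeConjInv Θ)).comp (A.halfTwistToTensor (CMTypeOps.bar Θ))).map_F_le P
    rw [A.halfTwist_bar_one_F Θ P] at h
    exact h

/-- The underlying map of `posHalfTwistTateToTensor` is `(1 ⊗ c) ∘ j`. [cite: vanGeemen2001HalfTwists, Prop. 2.8 (second clause)] -/
@[simp]
theorem posHalfTwistTateToTensor_toLinearMap :
    (A.posHalfTwistTateToTensor Θ).toLinearMap = (conjLinear E).lTensor V ∘ₗ A.tensorEmbedding := rfl

/-- **The retraction `V ⊗_ℚ K_{-1/2} ⟶ V_{1/2}(-1)`**, `μ ∘ (1 ⊗ c)` (the projection onto the eigenspace `V''` in van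
Geemen's first proof), a morphism of Hodge structures. [cite: vanGeemen2001HalfTwists, Prop. 2.8 (second clause, first proof)] -/
def tensorToPosHalfTwistTate :
    Hom (H.tensor (ofCMType Θ)) (((A.halfTwist Θ (-1)).tateTwist (-1)).cast (by ring : n + -1 - 2 * -1 = n + 1)) where
  toLinearMap := A.actionMap ∘ₗ (conjLinear E).lTensor V
  map_F_le P := by
    have h := ((A.tensorToHalfTwist (CMTypeOps.bar Θ)).comp (Hom.tensorMap (Hom.id H) (ofCMTypeConj Θ))).map_F_le P
    rw [A.halfTwist_bar_one_F Θ P] at h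
    exact h

/-- The underlying map of `tensorToPosHalfTwistTate` is `μ ∘ (1 ⊗ c)`. [cite: vanGeemen2001HalfTwists, Prop. 2.8 (second clause)] -/
@[simp]
theorem tensorToPosHalfTwistTate_toLinearMap :
    (A.tensorToPosHalfTwistTate Θ).toLinearMap = A.actionMap ∘ₗ (conjLinear E).lTensor V := rfl

omit [HodgeTensorFacts.{u, u}] in
/-- `(1 ⊗ c) ∘ (1 ⊗ c) = id` on `V ⊗ E`. [cite: vanGeemen2001HalfTwists, §2.3] -/
theorem lTensor_conjLinear_lTensor_conjLinear (z : V ⊗[ℚ] E) :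
    (conjLinear E).lTensor V ((conjLinear E).lTensor V z) = z := by
  rw [← LinearMap.comp_apply, ← LinearMap.lTensor_comp, conjLinear_comp_conjLinear, LinearMap.lTensor_id,
    LinearMap.id_apply]

/-- **`V_{1/2}(-1)` IS A DIRECT SUMMAND OF `V ⊗_ℚ K_{-1/2}` in the category of `ℚ`-Hodge structures**:
`(μ ∘ (1 ⊗ c)) ∘ ((1 ⊗ c) ∘ j) = μ ∘ j = id`. [cite: vanGeemen2001HalfTwists, Prop. 2.8 (second clause)] -/
theorem tensorToPosHalfTwistTate_posHalfTwistTateToTensor_apply (v : V) :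
    (A.tensorToPosHalfTwistTate Θ).toLinearMap ((A.posHalfTwistTateToTensor Θ).toLinearMap v) = v := by
  rw [posHalfTwistTateToTensor_toLinearMap, tensorToPosHalfTwistTate_toLinearMap, LinearMap.comp_apply,
    LinearMap.comp_apply, lTensor_conjLinear_lTensor_conjLinear]
  exact A.actionMap_tensorEmbedding v

/-- Composition form of the retraction. [cite: vanGeemen2001HalfTwists, Prop. 2.8 (second clause)] -/
theorem tensorToPosHalfTwistTate_comp_posHalfTwistTateToTensor :
    (A.tensorToPosHalfTwistTate Θ).comp (A.posHalfTwistTateToTensor Θ) = Hom.id _ :=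
  Hom.ext (LinearMap.ext (A.tensorToPosHalfTwistTate_posHalfTwistTateToTensor_apply Θ))

/-- `posHalfTwistTateToTensor` is injective: "`V_{1/2}(-1)` is a sub-Hodge structure of `V ⊗_ℚ K_{-1/2}`".
[cite: vanGeemen2001HalfTwists, Prop. 2.8 (second clause)] -/
theorem posHalfTwistTateToTensor_injective : Function.Injective (A.posHalfTwistTateToTensor Θ).toLinearMap :=
  Function.LeftInverse.injective (A.tensorToPosHalfTwistTate_posHalfTwistTateToTensor_apply Θ)

omit [HodgeTensorFacts.{u, u}] in
/-- `1 ⊗ c` intertwines `1 ⊗ (x·)` and `1 ⊗ (x̄·)`. [cite: vanGeemen2001HalfTwists, Prop. 2.8 (second clause)] -/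
private theorem lTensor_lmul_comp_lTensor_conjLinear (x : E) :
    (Algebra.lmul ℚ E (conjLinear E x) : E →ₗ[ℚ] E).lTensor V ∘ₗ (conjLinear E).lTensor V =
      (conjLinear E).lTensor V ∘ₗ (Algebra.lmul ℚ E x : E →ₗ[ℚ] E).lTensor V := by
  rw [← LinearMap.lTensor_comp, ← LinearMap.lTensor_comp, lmul_conjLinear_comp_conjLinear]

omit [HodgeTensorFacts.{u, u}] in
/-- `1 ⊗ c` commutes with `ι(x) ⊗ 1`. [cite: vanGeemen2001HalfTwists, Prop. 2.8 (second clause)] -/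
private theorem rTensor_ι_comp_lTensor_conjLinear (x : E) :
    (A.ι x : V →ₗ[ℚ] V).rTensor E ∘ₗ (conjLinear E).lTensor V =
      (conjLinear E).lTensor V ∘ₗ (A.ι x : V →ₗ[ℚ] V).rTensor E := by
  rw [LinearMap.rTensor_comp_lTensor, LinearMap.lTensor_comp_rTensor]

/-- **"MORE PRECISELY": the image of `V_{1/2}(-1)` in `V ⊗_ℚ K_{-1/2}` is
`V'' = {w : (x ⊗ 1) w = (1 ⊗ x̄) w for all x ∈ K}`** (`(1 ⊗ c)` carries row g16-#1's `V' = {(x ⊗ 1) w = (1 ⊗ x) w}`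
= `range j` onto `V''`). [cite: vanGeemen2001HalfTwists, Prop. 2.8 (second clause)] -/
theorem range_posHalfTwistTateToTensor_eq :
    LinearMap.range (A.posHalfTwistTateToTensor Θ).toLinearMap =
      ⨅ x : E, LinearMap.eqLocus ((A.ι x : V →ₗ[ℚ] V).rTensor E)
        ((Algebra.lmul ℚ E (conjLinear E x) : E →ₗ[ℚ] E).lTensor V) := by
  rw [posHalfTwistTateToTensor_toLinearMap, LinearMap.range_comp, range_tensorEmbedding_eq]
  ext w
  constructor
  · rintro ⟨w', hw', rfl⟩
    refine (Submodule.mem_iInf _).2 fun x => LinearMap.mem_eqLocus.2 ?_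
    have hx := LinearMap.mem_eqLocus.1 ((Submodule.mem_iInf _).1 hw' x)
    rw [← LinearMap.comp_apply, rTensor_ι_comp_lTensor_conjLinear, LinearMap.comp_apply, hx, ← LinearMap.comp_apply,
      ← lTensor_lmul_comp_lTensor_conjLinear, LinearMap.comp_apply]
  · intro hw
    refine ⟨(conjLinear E).lTensor V w, (Submodule.mem_iInf _).2 fun x => LinearMap.mem_eqLocus.2 ?_,
      lTensor_conjLinear_lTensor_conjLinear w⟩
    have hx := LinearMap.mem_eqLocus.1 ((Submodule.mem_iInf _).1 hw x)
    have h' : (Algebra.lmul ℚ E x : E →ₗ[ℚ] E).lTensor V ((conjLinear E).lTensor V w) =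
        (conjLinear E).lTensor V ((Algebra.lmul ℚ E (conjLinear E x) : E →ₗ[ℚ] E).lTensor V w) := by
      have h := LinearMap.congr_fun (lTensor_lmul_comp_lTensor_conjLinear (V := V) (conjLinear E x)) w
      simp only [LinearMap.coe_comp, Function.comp_apply, conjLinear_conjLinear] at h
      exact h
    rw [h', ← hx, ← LinearMap.comp_apply, rTensor_ι_comp_lTensor_conjLinear, LinearMap.comp_apply]

end SecondClause

end EndAction

/-! ## §3 Half twists preserve abelian type (van Geemen §2.9) -/

section AbelianType

variable {V : Type} [AddCommGroup V] [Module ℚ V] {n : ℤ} {E : Type} [Field E] [NumberField E]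
  {H : HodgeStructure V n}

/-- Transport back along `HodgeStructure.cast` (same space, same filtration). [cite: Andre1996Motifs, §6.1 (p. 30)] -/
theorem IsOfAbelianType.of_cast {w' : ℤ} (e : n = w') (h : (H.cast e).IsOfAbelianType) : H.IsOfAbelianType := by
  subst e
  exact h.of_retract (Hom.ofEqF fun p => (cast_F H rfl p).symm) (Hom.ofEqF fun p => cast_F H rfl p) fun _ => rfl

/-- **`V{-1/2}_Θ` is of abelian type when `V` is** — it is a direct summand of `V ⊗ V¹_{(E,Θ)}` (row g16-#1, Prop. 2.8
first clause), `V¹_{(E,Θ)} = H¹(A_K, ℚ)` is of abelian type (row g16-#2), and `ℳ(𝒜b)` is closed under `⊗` and direct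
summands. Here for any type `Θ` that is a CM-type in Shimura's sense (e.g. every type of a CM field).
[cite: vanGeemen2001HalfTwists, §2.9 and §2.7] [cite: Andre1996Motifs, §6.1 (p. 30)] -/
theorem IsOfAbelianType.halfTwist_one_of_isShimuraCMType (hH : H.IsOfAbelianType) (A : EndAction H E) (Θ : CMType E)
    (hΘ : Literature.NumberTheory.ComplexMultiplication.IsShimuraCMType Θ.1) : (A.halfTwist Θ 1).IsOfAbelianType := by
  haveI : HodgeTensorFacts.{0, 0} := hodgeTensorFacts_holds.{0, 0}
  exact (hH.tensor
    (Literature.AlgebraicGeometry.ComplexMultiplication.isOfAbelianType_ofCMType_of_isShimuraCMType Θ hΘ)).of_retract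
    (A.halfTwistToTensor Θ) (A.tensorToHalfTwist Θ) (A.tensorToHalfTwist_halfTwistToTensor_apply Θ)

variable [IsCMField E] (A : EndAction H E) (Θ : CMType E)

/-- **`V_{-1/2} = V{-1/2}_Θ` is of abelian type when `V` is** (CM field `E`, any type `Θ`): a direct summand of
`V ⊗ H¹(A_K, ℚ)`. [cite: vanGeemen2001HalfTwists, §2.9 and Prop. 2.8] [cite: Andre1996Motifs, §6.1 (p. 30)] -/
theorem IsOfAbelianType.halfTwist_one (hH : H.IsOfAbelianType) : (A.halfTwist Θ 1).IsOfAbelianType := by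
  haveI : HodgeTensorFacts.{0, 0} := hodgeTensorFacts_holds.{0, 0}
  exact (hH.tensor (Literature.AlgebraicGeometry.ComplexMultiplication.isOfAbelianType_ofCMType Θ)).of_retract
    (A.halfTwistToTensor Θ) (A.tensorToHalfTwist Θ) (A.tensorToHalfTwist_halfTwistToTensor_apply Θ)

/-- **`V` is of abelian type when `V_{1/2} = V{1/2}_Θ` is** — GGK's rule "`V` is a sub-Hodge structure of
`V{1/2}_Θ ⊗ V¹_{(F,Θ)}`" = van Geemen's third clause (row g16-#1 `toPosHalfTwistTensor` / `ofPosHalfTwistTensor`).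
[cite: GreenGriffithsKerr2012, §V.D p. 163] [cite: vanGeemen2001HalfTwists, Prop. 2.8] [cite: Andre1996Motifs, §6.1 (p. 30)] -/
theorem IsOfAbelianType.of_halfTwist_neg_one (h : (A.halfTwist Θ (-1)).IsOfAbelianType) : H.IsOfAbelianType := by
  haveI : HodgeTensorFacts.{0, 0} := hodgeTensorFacts_holds.{0, 0}
  exact ((h.tensor (Literature.AlgebraicGeometry.ComplexMultiplication.isOfAbelianType_ofCMType Θ)).cast
    (show n + -1 + 1 = n by ring)).of_retract (A.toPosHalfTwistTensor Θ) (A.ofPosHalfTwistTensor Θ)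
    (A.ofPosHalfTwistTensor_toPosHalfTwistTensor_apply Θ)

/-- **`V_{1/2} = V{1/2}_Θ` is of abelian type when `V` is**: `V_{1/2} = V{-1/2}_{Θ̄}(1)` (§1) and `ℳ(𝒜b)` contains the
Tate objects — van Geemen's "`V_{1/2}(-1)` is a sub-Hodge structure of `H^k(X, ℚ) ⊗ H^1(A_K, ℚ)`".
[cite: vanGeemen2001HalfTwists, §2.9 and Prop. 2.8 (second clause)] [cite: Andre1996Motifs, §6.1 (p. 30)] -/
theorem IsOfAbelianType.halfTwist_neg_one (hH : H.IsOfAbelianType) : (A.halfTwist Θ (-1)).IsOfAbelianType := by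
  rw [A.halfTwist_neg_eq_cast Θ 1]
  exact ((hH.halfTwist_one A (CMTypeOps.bar Θ)).tateTwist 1).cast _

/-- **`V` is of abelian type when `V_{-1/2} = V{-1/2}_Θ` is** (`V = V{-1/2}{1/2}`, and the previous result for the twisted
action). [cite: vanGeemen2001HalfTwists, §2.9 and §2.5] [cite: Andre1996Motifs, §6.1 (p. 30)] -/
theorem IsOfAbelianType.of_halfTwist_one (h : (A.halfTwist Θ 1).IsOfAbelianType) : H.IsOfAbelianType := by
  have h' := h.halfTwist_neg_one (A.halfTwistAction Θ 1) Θ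
  rw [A.halfTwistAction_halfTwist_neg_eq_cast Θ 1] at h'
  exact IsOfAbelianType.of_cast _ h'

/-- **HALF TWISTS PRESERVE ABELIAN TYPE: if `V` is of abelian type then so is every `V{-b/2}_Θ`, `b ∈ ℤ`** (iterate the
one-step twists, `(V_{n/2})_{m/2} = V_{(n+m)/2}`). For `V ⊂ H^k(X, ℚ)` with `X` an abelian variety this is van Geemen's
§2.9 iterated: `V_{-b/2}` sits in the cohomology of `X × A_K^b` up to Tate twists.
[cite: vanGeemen2001HalfTwists, §2.9 and §2.5] [cite: Andre1996Motifs, §6.1 (p. 30)] -/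
theorem IsOfAbelianType.halfTwist (hH : H.IsOfAbelianType) (A : EndAction H E) (Θ : CMType E) (b : ℤ) :
    (A.halfTwist Θ b).IsOfAbelianType := by
  induction b using Int.induction_on with
  | zero =>
    rw [A.halfTwist_zero_eq_cast Θ]
    exact hH.cast _
  | succ k ih =>
    have h1 := ih.halfTwist_one (A.halfTwistAction Θ k) Θ
    rw [A.halfTwistAction_halfTwist_eq_cast Θ k 1] at h1
    exact IsOfAbelianType.of_cast _ h1
  | pred k ih =>
    have h1 := ih.halfTwist_neg_one (A.halfTwistAction Θ (-k)) Θ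
    rw [A.halfTwistAction_halfTwist_eq_cast Θ (-k) (-1)] at h1
    rw [sub_eq_add_neg]
    exact IsOfAbelianType.of_cast _ h1

/-- **`V{-b/2}_Θ` is of abelian type iff `V` is.** [cite: vanGeemen2001HalfTwists, §2.9 and §2.5] [cite: Andre1996Motifs, §6.1 (p. 30)] -/
theorem isOfAbelianType_halfTwist_iff (b : ℤ) : (A.halfTwist Θ b).IsOfAbelianType ↔ H.IsOfAbelianType := by
  refine ⟨fun h => ?_, fun h => h.halfTwist A Θ b⟩
  have h' := h.halfTwist (A.halfTwistAction Θ b) Θ (-b)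
  rw [A.halfTwistAction_halfTwist_neg_eq_cast Θ b] at h'
  exact IsOfAbelianType.of_cast _ h'

/-- **GEOMETRICAL VERSION (van Geemen §2.9)**: a sub-Hodge structure `V ↪ W` of a structure `W` of abelian type (e.g.
`W = H^k(X, ℚ)` for a complex abelian variety `X`, the tree's `isOfAbelianType_complexTorus_hodgeStructure`), stable
under an action of a CM field `E` by Hodge endomorphisms, has all its half twists `V{-b/2}_Θ` of abelian type.
[cite: vanGeemen2001HalfTwists, §2.9] [cite: Andre1996Motifs, §6.1 (p. 30)] -/
theorem IsOfAbelianType.halfTwist_of_injective {V' : Type} [AddCommGroup V'] [Module ℚ V'] {W : HodgeStructure V' n}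
    (hW : W.IsOfAbelianType) (f : Hom H W) (hf : Function.Injective f.toLinearMap) (A : EndAction H E) (Θ : CMType E)
    (b : ℤ) : (A.halfTwist Θ b).IsOfAbelianType :=
  (hW.of_injective f hf).halfTwist A Θ b

end AbelianType

/-! ## §4 Half twists preserve polarizability (van Geemen §2.11, first paragraph) -/

section Polarizable

variable {V : Type} [AddCommGroup V] [Module ℚ V] [Module.Finite ℚ V] {n : ℤ} {E : Type} [Field E] [NumberField E]
  [IsCMField E] {H : HodgeStructure V n} (A : EndAction H E) (Θ : CMType E)

omit [Module.Finite ℚ V] in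
/-- Transport back along `HodgeStructure.cast`. [cite: DeligneHodgeII1971, 2.1.15] -/
theorem IsPolarizable.of_cast {w' : ℤ} (e : n = w') (h : (H.cast e).IsPolarizable) : H.IsPolarizable := by
  subst e
  exact h.of_injective (Hom.ofEqF fun p => (cast_F H rfl p).symm) fun _ _ hxy => hxy

/-- **`V_{-1/2}` is polarizable when `V` is**: "If `V` has a polarization, then also `V ⊗ K_{-1/2}` has a polarization (the
tensor product polarization) and by restriction one obtains a polarization" on the sub-Hodge structure `V_{-1/2}` (Prop. 2.8,
first clause; `K_{-1/2} = V¹_{(E,Θ)}` is polarized by `Tr(ζ x̄ y)`, the tree's `isPolarizable_ofCMType`).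
[cite: vanGeemen2001HalfTwists, §2.11] [cite: DeligneHodgeII1971, 2.1.15] -/
theorem IsPolarizable.halfTwist_one (hH : H.IsPolarizable) : (A.halfTwist Θ 1).IsPolarizable := by
  haveI : HodgeTensorFacts.{0, 0} := hodgeTensorFacts_holds.{0, 0}
  exact (hH.tensor (isPolarizable_ofCMType Θ)).of_injective (A.halfTwistToTensor Θ) (A.halfTwistToTensor_injective Θ)

/-- **`V` is polarizable when `V_{1/2}` is** (restriction along `V ⊂ V_{1/2} ⊗ K_{-1/2}`, Prop. 2.8 third clause).
[cite: vanGeemen2001HalfTwists, §2.11 and Prop. 2.8] [cite: GreenGriffithsKerr2012, §V.D p. 163] -/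
theorem IsPolarizable.of_halfTwist_neg_one (h : (A.halfTwist Θ (-1)).IsPolarizable) : H.IsPolarizable := by
  haveI : HodgeTensorFacts.{0, 0} := hodgeTensorFacts_holds.{0, 0}
  exact ((h.tensor (isPolarizable_ofCMType Θ)).cast (show n + -1 + 1 = n by ring)).of_injective
    (A.toPosHalfTwistTensor Θ) (A.toPosHalfTwistTensor_injective Θ)

/-- **`V_{1/2}` is polarizable when `V` is**: "by restriction one obtains a polarization on `V_{1/2}`" — along
`V_{1/2}(-1) ⊂ V ⊗ K_{-1/2}` (Prop. 2.8, second clause; here through `V_{1/2} = V{-1/2}_{Θ̄}(1)`).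
[cite: vanGeemen2001HalfTwists, §2.11 and Prop. 2.8 (second clause)] [cite: DeligneHodgeII1971, 2.1.15] -/
theorem IsPolarizable.halfTwist_neg_one (hH : H.IsPolarizable) : (A.halfTwist Θ (-1)).IsPolarizable := by
  rw [A.halfTwist_neg_eq_cast Θ 1]
  exact ((hH.halfTwist_one A (CMTypeOps.bar Θ)).tateTwist 1).cast _

/-- **`V` is polarizable when `V_{-1/2}` is** (`V = V{-1/2}{1/2}`). [cite: vanGeemen2001HalfTwists, §2.11 and §2.5] -/
theorem IsPolarizable.of_halfTwist_one (h : (A.halfTwist Θ 1).IsPolarizable) : H.IsPolarizable := by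
  have h' := h.halfTwist_neg_one (A.halfTwistAction Θ 1) Θ
  rw [A.halfTwistAction_halfTwist_neg_eq_cast Θ 1] at h'
  exact IsPolarizable.of_cast _ h'

/-- **HALF TWISTS PRESERVE POLARIZABILITY: `V` polarizable ⟹ every `V{-b/2}_Θ` polarizable** (`E` a CM field).
[cite: vanGeemen2001HalfTwists, §2.11 and §2.5] [cite: DeligneHodgeII1971, 2.1.15] -/
theorem IsPolarizable.halfTwist (hH : H.IsPolarizable) (A : EndAction H E) (Θ : CMType E) (b : ℤ) :
    (A.halfTwist Θ b).IsPolarizable := by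
  induction b using Int.induction_on with
  | zero =>
    rw [A.halfTwist_zero_eq_cast Θ]
    exact hH.cast _
  | succ k ih =>
    have h1 := ih.halfTwist_one (A.halfTwistAction Θ k) Θ
    rw [A.halfTwistAction_halfTwist_eq_cast Θ k 1] at h1
    exact IsPolarizable.of_cast _ h1
  | pred k ih =>
    have h1 := ih.halfTwist_neg_one (A.halfTwistAction Θ (-k)) Θ
    rw [A.halfTwistAction_halfTwist_eq_cast Θ (-k) (-1)] at h1
    rw [sub_eq_add_neg]
    exact IsPolarizable.of_cast _ h1

/-- **`V{-b/2}_Θ` is polarizable iff `V` is.** [cite: vanGeemen2001HalfTwists, §2.11 and §2.5] -/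
theorem isPolarizable_halfTwist_iff (b : ℤ) : (A.halfTwist Θ b).IsPolarizable ↔ H.IsPolarizable := by
  refine ⟨fun h => ?_, fun h => h.halfTwist A Θ b⟩
  have h' := h.halfTwist (A.halfTwistAction Θ b) Θ (-b)
  rw [A.halfTwistAction_halfTwist_neg_eq_cast Θ b] at h'
  exact IsPolarizable.of_cast _ h'

end Polarizable

end HodgeStructure

end Literature.AlgebraicGeometry.Motives
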